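import Summits.QuantumFields.YangMills.Theorems.SwapVirialDeficitGnomonicJetDeficit
import Summits.QuantumFields.YangMills.Theorems.SwapVirialDeficitBlowUpGnomonicDeficitDefs
import Summits.QuantumFields.YangMills.Theorems.SwapVirialDeficitGnomonicEulerRemainder
import HarnessLib

/-!
# THIRD-ORDER S-B, part J4: THE EULER REMAINDER `R = F̂ − ½XF̂` IS CUBIC IN THE LETTER SIZE — `|R| ≤ 1242000·L⁴·A³`
# (free-hands support of ⟨stmt-QuantumFields-24197⟩ `SwapVirialDeficit.SwapGluedStiffness`)

The pointwise input of the `R`-term of the virial window row (LW) (fcl-p3 g46 memo 2 §3; ✓`virial_ring`: `b·E_z = (9L⁴−1)Z_z − ½K_L⟪W⟫_z + bK_L⟪R⟫_z`,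
`R := gnoDeficit − gnoXDeficit/2`).  With `φ(t) := F̂(eulerDilate t η) = chartDeficit L z χ (blowUpPoint t (gnomonicPoint a ε η))` (✓`gnoDeficit_eulerDilate`):
`F̂ η = φ(1)`, `XF̂ η = d/ds|₀ φ(e^s)` (✓`gnoXDeficit`), and w2 g57's ✓`abs_sub_half_flowDeriv_le_of_third` gives `|φ(1) − ½φ′(1)| ≤ ½ sup_{[0,1]} |φ‴|`
once `φ(0) = 0` and `φ′(0) = 0`.  Part J3b (✓`realJet3_chartDeficit_gnomonic_le`) supplies `|φ‴| ≤ 2484000·L⁴·A³` when all letter sizes are `≤ A`.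
* §1 ★ `gnoXDeficit_eq_of_hasDerivAt` — `XF̂ η = φ′(1)` for any derivative witness; ★★ `abs_gnoXDeficit_le_size` — the SIZE-SENSITIVE first-order S-B
  `|XF̂ η| ≤ 720·L⁴·A` (w2's ✓`abs_gnoXDeficit_le` is the uniform `324·L⁴`; here the bound vanishes linearly at the flat axial point);
* §2 ★★★ `abs_gnoDeficit_sub_half_gnoXDeficit_le` — for hub `a ≠ 0`, a sign ∕ sector pattern FLAT at the axial point (`F̂(eulerDilate 0 η) = 0`; then
  `φ′(0) = 0` because `F̂ ≥ 0`, ✓`IsLocalMin.hasDerivAt_eq_zero`) and all letter sizes `≤ A`:  `|F̂ η − ½·XF̂ η| ≤ 1242000·L⁴·A³`.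
USE (memo 2 §3, the θ-split): in the small-field region on good hubs `G_θ`, w2's ✓`leadersW_hubStiff_le` and ✓`chartBox_of_chartDeficit` bound every letter
size by `A² ≲ L⁶·F̂/θ` (`gnoWtr = 4τ²/(1+τ²)`, `gnomonicW = 4ζ²/(1+ζ²)`), so `|R| ≲ L¹³·θ^{−3/2}·F̂^{3/2}` there, and w3 g65's ✓`swap_deficit_threeHalves_window`-type
moment bound makes `βK_L⟪|R|·1_{small,good}⟫₀ = o(1)·Z₀` on a window for `θ ≥ β^{−γ}`, `γ < 1/3`.  Bad hubs ∕ large field ∕ non-flat sign patterns are NOT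
covered here (valley structure resp. ✓`largeField_share_le`).

HONEST LABEL: a pointwise calculus bound with an explicit polynomial constant; no estimate on the ring's Gibbs state; nothing about ⟨24197⟩ (window-uniform,
OPEN), (LW), (M), (HM) is proved; ⟨24194⟩ ∕ ⟨24196⟩ ∕ ⟨24497⟩ OPEN; item of record ⟨24085⟩ SubOctaveBounded aside ∕ untouched; no crux, rung of record or summit is
proved; the Yang–Mills mass gap is NOT proved; no summit is proved by a line.  THEOREMS ONLY (0 `def`, 0 `sorry`), standard axioms, no local instances.  Seat ym-line-fcl-p3 g47 (cell ym-idea-1, free hands),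
`--supports stmt-QuantumFields-24197`.  References: [cite: Luscher1983, §2]; [folklore] (Taylor's theorem).
-/

set_option autoImplicit false
set_option synthInstance.maxSize 1024

noncomputable section

open Quaternion Set
open scoped Quaternion BigOperators
open Literature.MathematicalPhysics.QuantumLattice
open Literature.MathematicalPhysics.QuantumFieldTheory hiding SU2
open Summit.QuantumFields.YangMills.Theorems.FemtoTransferGap
open Summit.QuantumFields.YangMills.Theorems.FemtoTransferGap.TT
open Summit.QuantumFields.YangMills.Theorems.SwapVirialDeficit.BlowUpRing

namespace Summit.QuantumFields.YangMills.Theorems.SwapVirialDeficit.Gnomonic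

variable {L : ℕ} [NeZero L]

/-! ## §1 The Euler derivative is `φ′(1)`; the size-sensitive first-order bound -/

/-- ★ **`XF̂ η = φ′(1)`**: for any derivative witness `d₁` of `φ(t) = chartDeficit L z χ (blowUpPoint t (gnomonicPoint a ε η))` one has
`gnoXDeficit z χ a ε η = d₁ 1` (✓`gnoDeficit_eulerDilate`, ✓`hasDerivAt_comp_exp_zero`). [folklore] -/
theorem gnoXDeficit_eq_of_hasDerivAt (z : Fin 3 → Bool) (χ : Site 3 L → SU2) (a : ℍ) (ε : GnoSign L) (η : GnoCoord L) {d₁ : ℝ → ℝ}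
    (h : ∀ t, HasDerivAt (fun t : ℝ => chartDeficit L z χ (blowUpPoint t (gnomonicPoint a ε η))) (d₁ t) t) :
    gnoXDeficit z χ a ε η = d₁ 1 := by
  have e : (fun s : ℝ => gnoDeficit z χ a ε (eulerDilate (Real.exp s) η)) =
      fun s => chartDeficit L z χ (blowUpPoint (Real.exp s) (gnomonicPoint a ε η)) := funext fun s => gnoDeficit_eulerDilate z χ a ε η _
  have hd : HasDerivAt (fun s : ℝ => chartDeficit L z χ (blowUpPoint (Real.exp s) (gnomonicPoint a ε η))) (d₁ 1) 0 :=
    hasDerivAt_comp_exp_zero (φ := fun t : ℝ => chartDeficit L z χ (blowUpPoint t (gnomonicPoint a ε η))) (h 1)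
  unfold gnoXDeficit
  rw [e]
  exact hd.deriv

/-- ★★ **SIZE-SENSITIVE FIRST-ORDER S-B**: with all letter sizes `≤ A` (hub `a ≠ 0`), `|XF̂ η| ≤ 720·L⁴·A` — the Euler derivative vanishes linearly at the
flat axial point (compare the uniform `324·L⁴` of ✓`abs_gnoXDeficit_le`). [cite: Luscher1983, §2] -/
theorem abs_gnoXDeficit_le_size (z : Fin 3 → Bool) (χ : Site 3 L → SU2) {a : ℍ} (ha : a ≠ 0) (ε : GnoSign L) (η : GnoCoord L) {A : ℝ} (hA : 0 ≤ A)
    (hx : Real.sqrt ((η.1.1 1 ^ 2 + η.1.1 2 ^ 2) / (1 + η.1.1 0 ^ 2)) ≤ A) (hy : Real.sqrt ((η.1.2 1 ^ 2 + η.1.2 2 ^ 2) / (1 + η.1.2 0 ^ 2)) ≤ A)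
    (hz : Real.sqrt (∑ k, η.2.1 k ^ 2) ≤ A) (hf : ∀ i, Real.sqrt (∑ k, η.2.2 i k ^ 2) ≤ A) :
    |gnoXDeficit z χ a ε η| ≤ 720 * (L : ℝ) ^ 4 * A := by
  obtain ⟨d₁, d₂, d₃, h₁, -, -, hb⟩ := realJet3_chartDeficit_gnomonic_le z χ ha ε η hA hx hy hz hf
  rw [gnoXDeficit_eq_of_hasDerivAt z χ a ε η h₁]
  exact (hb 1).1

/-! ## §2 The Euler remainder is cubic in the letter size -/

/-- ★★★ **THE EULER REMAINDER OF THE σ-GLUED DEFICIT IS CUBIC IN THE LETTER SIZE**: for hub `a ≠ 0`, a sign ∕ sector pattern that is FLAT at the axial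
point (`F̂(eulerDilate 0 η) = 0`) and all letter sizes `≤ A` (`τ(η.1.1), τ(η.1.2) ≤ A` for the transversely dilated `x, y`; `√Σ(η.2.1)ₖ² ≤ A` for `z`;
`√Σ(η.2.2 i)ₖ² ≤ A` for every follower), `|F̂ η − ½·XF̂ η| ≤ 1242000·L⁴·A³`. [cite: Luscher1983, §2] -/
theorem abs_gnoDeficit_sub_half_gnoXDeficit_le (z : Fin 3 → Bool) (χ : Site 3 L → SU2) {a : ℍ} (ha : a ≠ 0) (ε : GnoSign L) (η : GnoCoord L) {A : ℝ}
    (hA : 0 ≤ A) (hx : Real.sqrt ((η.1.1 1 ^ 2 + η.1.1 2 ^ 2) / (1 + η.1.1 0 ^ 2)) ≤ A) (hy : Real.sqrt ((η.1.2 1 ^ 2 + η.1.2 2 ^ 2) / (1 + η.1.2 0 ^ 2)) ≤ A)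
    (hz : Real.sqrt (∑ k, η.2.1 k ^ 2) ≤ A) (hf : ∀ i, Real.sqrt (∑ k, η.2.2 i k ^ 2) ≤ A) (h0 : gnoDeficit z χ a ε (eulerDilate 0 η) = 0) :
    |gnoDeficit z χ a ε η - gnoXDeficit z χ a ε η / 2| ≤ 1242000 * (L : ℝ) ^ 4 * A ^ 3 := by
  obtain ⟨d₁, d₂, d₃, h₁, h₂, h₃, hb⟩ := realJet3_chartDeficit_gnomonic_le z χ ha ε η hA hx hy hz hf
  -- `F̂ η = φ 1`, `XF̂ η = d/ds|₀ φ(e^s)` for `φ t = chartDeficit L z χ (blowUpPoint t (gnomonicPoint a ε η))`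
  have eF : gnoDeficit z χ a ε η = chartDeficit L z χ (blowUpPoint 1 (gnomonicPoint a ε η)) := by
    rw [← gnoDeficit_eulerDilate z χ a ε η 1, eulerDilate_one]
  have eX : gnoXDeficit z χ a ε η = deriv (fun s : ℝ => chartDeficit L z χ (blowUpPoint (Real.exp s) (gnomonicPoint a ε η))) 0 := by
    have e : (fun s : ℝ => gnoDeficit z χ a ε (eulerDilate (Real.exp s) η)) =
        fun s => chartDeficit L z χ (blowUpPoint (Real.exp s) (gnomonicPoint a ε η)) := funext fun s => gnoDeficit_eulerDilate z χ a ε η _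
    unfold gnoXDeficit
    rw [e]
  -- `φ 0 = 0` and `φ′ 0 = 0` (a minimum of the nonnegative `φ`)
  have hφ0 : chartDeficit L z χ (blowUpPoint 0 (gnomonicPoint a ε η)) = 0 := by rw [← gnoDeficit_eulerDilate z χ a ε η 0]; exact h0
  have hmin : IsLocalMin (fun t : ℝ => chartDeficit L z χ (blowUpPoint t (gnomonicPoint a ε η))) 0 :=
    Filter.Eventually.of_forall fun t => show chartDeficit L z χ (blowUpPoint 0 (gnomonicPoint a ε η)) ≤
        chartDeficit L z χ (blowUpPoint t (gnomonicPoint a ε η)) from by rw [hφ0]; exact chartDeficit_nonneg z χ _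
  have hd₁0 : d₁ 0 = 0 := hmin.hasDerivAt_eq_zero (h₁ 0)
  have hR := abs_sub_half_flowDeriv_le_of_third (φ := fun t : ℝ => chartDeficit L z χ (blowUpPoint t (gnomonicPoint a ε η)))
    h₁ h₂ h₃ hφ0 hd₁0 (fun t _ => (hb t).2.2)
  rw [eF, eX]
  refine hR.trans ?_
  nlinarith [pow_nonneg (Nat.cast_nonneg L : (0 : ℝ) ≤ L) 4, pow_nonneg hA 3]

end Summit.QuantumFields.YangMills.Theorems.SwapVirialDeficit.Gnomonic

end
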